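import Literature.Geometry.Riemannian.ExpMapEnergyTaylor
import Literature.Geometry.Riemannian.ExponentialMapProofs
import HarnessLib

/-!
# Minimizing geodesics have nonnegative index form on broken fields
(Lee 2018, Thm. 10.26 / Cor. 10.23: "if `Γ` is any proper variation of a minimizing curve,
then the second variation is nonnegative")

Layer 6f of the programme for `Literature.Geometry.Riemannian.lee_expMap_injectivityDomain`
(Lee 2018, Thm. 10.34, part "bijective differential on `ID(p)`", via Thm. 10.26). Let `g` be a
smooth Riemannian metric with complete Levi-Civita connection, `γ(t) = exp_p(tu)` a geodesic which
is minimizing on `[0, s₀]`, `s₀ > 1` (`IsMinimizingUpTo`), and let `X₁`, `X₂` be `C^∞` fields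
along `γ` (broken field: `X₁` on `[0,1]`, `X₂` on `[1,s₀]`) with `X₁(0) = 0`, `X₁(1) = X₂(1)`,
`X₂(s₀) = 0`. Then

* `energy_ge_of_isMinimizingUpTo` — for every `σ`, the energy of the broken curve
  `t ↦ exp_{γ(t)}(σ Xᵢ(t))` from `p` to `γ(s₀)` is at least `s₀ g(u, u)`, the energy of `γ`
  (minimality of `γ`, the triangle inequality, `L² ≤ (b - a) ∫|T|²`, Lee 2018, Problem 6-23);
* `index_nonneg_of_isMinimizingUpTo` — **the index form is nonnegative**:
  `0 ≤ ∫_0^1 [g(R(X₁,γ')X₁,γ') + |D_tX₁|²] + ∫_1^{s₀} [g(R(X₂,γ')X₂,γ') + |D_tX₂|²]`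
  (Lee 2018, Cor. 10.23 with the second variation formula Thm. 10.22, in the energy form of
  `integral_energy_le_taylor`: the first-order terms `∫ 2g(D_tXᵢ, γ') = 2[g(Xᵢ, γ')]` telescope to
  `0`, Thm. 6.3).

No definitions, no named facts (D-0026).

## References

* J. M. Lee, *Introduction to Riemannian Manifolds*, 2nd ed. (2018), Thm. 6.3, Problem 6-23,
  Thm. 10.22, Cor. 10.23, Thm. 10.26. [LeeRiemannianManifolds2018]
* B. O'Neill, *Semi-Riemannian geometry* (1983), Ch. 10, Thm. 17 and Cor. 18. [ONeill1983]
-/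

noncomputable section

open Bundle Set Filter Function MeasureTheory
open scoped Manifold ContDiff Topology

namespace Literature.Geometry.Riemannian

open Literature.Geometry.Lorentzian
open Literature.Geometry.Lorentzian.PseudoRiemannianMetric

variable {E : Type*} [NormedAddCommGroup E] [NormedSpace ℝ E] {H : Type*} [TopologicalSpace H]
  {I : ModelWithCorners ℝ E H} {M : Type*} [TopologicalSpace M] [ChartedSpace H M]
  [IsManifold I ∞ M] {n : ℕ∞ω} [FiniteDimensional ℝ E] [CompleteSpace E]
  (g : PseudoRiemannianMetric I n E (TangentSpace I : M → Type _)) [g.HasLeviCivita]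
  [T2Space M] [BoundarylessManifold I M]
  [CovariantDerivative.ContMDiffCovariantDerivative g.leviCivita 1]
  [CovariantDerivative.ContMDiffCovariantDerivative g.leviCivita ∞]

/-- **The energy of the broken variation is bounded below by the energy of the minimizing
geodesic** (Lee 2018, Problem 6-23 (b),(c), p. 190, with the definition of minimizing curves,
p. 151): if `γ(t) = exp_p(tu)` minimizes length on `[0, s₀]`, `s₀ > 1`, and `X₁(0) = 0`,
`X₁(1) = X₂(1)`, `X₂(s₀) = 0`, then for every `σ` the curve which is `t ↦ exp_{γ(t)}(σX₁(t))` on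
`[0,1]` and `t ↦ exp_{γ(t)}(σX₂(t))` on `[1,s₀]` runs from `p` to `γ(s₀)`, so
`s₀|u| = d(p, γ(s₀)) ≤ L₁ + L₂` (triangle inequality, `edist_le_length`), and
`Lᵢ² ≤ (bᵢ - aᵢ) ∫|T|²` (Cauchy–Schwarz) gives `s₀ g(u,u) ≤ ∫_0^1 |T|² + ∫_1^{s₀} |T|²`.
[cite: LeeRiemannianManifolds2018, Problem 6-23 and p. 151] -/
theorem energy_ge_of_isMinimizingUpTo (hn : (∞ : ℕ∞ω) ≤ n) (hg : g.IsRiemannian)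
    (hc : IsGeodesicallyComplete g.leviCivita) (p : M) (u : TangentSpace I p) {s₀ : ℝ}
    (hs₀ : 1 < s₀) (hmin : IsMinimizingUpTo g hg p u s₀)
    {X₁ X₂ : Π t : ℝ, TangentSpace I (expMap g.leviCivita p (t • u))}
    (hX₁ : ContMDiff 𝓘(ℝ, ℝ) I.tangent ∞
      (fun t ↦ (TotalSpace.mk' E (expMap g.leviCivita p (t • u)) (X₁ t) : TangentBundle I M)))
    (hX₂ : ContMDiff 𝓘(ℝ, ℝ) I.tangent ∞
      (fun t ↦ (TotalSpace.mk' E (expMap g.leviCivita p (t • u)) (X₂ t) : TangentBundle I M)))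
    (h0 : X₁ 0 = 0) (h1 : X₁ 1 = X₂ 1) (hs : X₂ s₀ = 0) (σ : ℝ) :
    s₀ * g.val p u u ≤
      (∫ t in (0 : ℝ)..1, g.val (expMap g.leviCivita (expMap g.leviCivita p (t • u)) (σ • X₁ t))
        (velocity I (fun t' ↦ expMap g.leviCivita (expMap g.leviCivita p (t' • u)) (σ • X₁ t')) t)
        (velocity I (fun t' ↦ expMap g.leviCivita (expMap g.leviCivita p (t' • u)) (σ • X₁ t')) t)) +
      ∫ t in (1 : ℝ)..s₀, g.val (expMap g.leviCivita (expMap g.leviCivita p (t • u)) (σ • X₂ t))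
        (velocity I (fun t' ↦ expMap g.leviCivita (expMap g.leviCivita p (t' • u)) (σ • X₂ t')) t)
        (velocity I (fun t' ↦ expMap g.leviCivita (expMap g.leviCivita p (t' • u)) (σ • X₂ t')) t) := by
  haveI : Fact (1 ≤ n) := ⟨le_trans (by exact_mod_cast le_top) hn⟩
  -- `g(v, v) ≥ 0` (positive semidefiniteness; cf. `PseudoRiemannianMetric.val_self_nonneg`)
  have hnn : ∀ (y : M) (v' : TangentSpace I y), 0 ≤ g.val y v' v' := fun y v' ↦ by
    by_cases hv : v' = 0
    · subst hv
      simp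
    · exact (hg y v' hv).le
  set x₁ : ℝ → ℝ → M := fun t σ ↦
    expMap g.leviCivita (expMap g.leviCivita p (t • u)) (σ • X₁ t) with hx₁_def
  set x₂ : ℝ → ℝ → M := fun t σ ↦
    expMap g.leviCivita (expMap g.leviCivita p (t • u)) (σ • X₂ t) with hx₂_def
  have hx₁ : ContMDiff (𝓘(ℝ, ℝ).prod 𝓘(ℝ, ℝ)) I ∞ (uncurry x₁) :=
    contMDiff_uncurry_expMap_smul_field hc hX₁
  have hx₂ : ContMDiff (𝓘(ℝ, ℝ).prod 𝓘(ℝ, ℝ)) I ∞ (uncurry x₂) :=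
    contMDiff_uncurry_expMap_smul_field hc hX₂
  have hline : ContMDiff 𝓘(ℝ, ℝ) (𝓘(ℝ, ℝ).prod 𝓘(ℝ, ℝ)) ∞ (fun t : ℝ ↦ ((t, σ) : ℝ × ℝ)) :=
    contMDiff_id.prodMk contMDiff_const
  have hγ₁ : ContMDiff 𝓘(ℝ, ℝ) I ∞ (fun t ↦ x₁ t σ) := hx₁.comp hline
  have hγ₂ : ContMDiff 𝓘(ℝ, ℝ) I ∞ (fun t ↦ x₂ t σ) := hx₂.comp hline
  -- the integrands are continuous in `t`
  have hTl₁ := contMDiff_lift_velocity_of_contMDiff (I := I) hγ₁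
  have hTl₂ := contMDiff_lift_velocity_of_contMDiff (I := I) hγ₂
  have hsm₁ : ContMDiff 𝓘(ℝ, ℝ) 𝓘(ℝ, ℝ) ∞ (fun t ↦ g.val (x₁ t σ) (velocity I (fun t' ↦ x₁ t' σ) t)
      (velocity I (fun t' ↦ x₁ t' σ) t)) :=
    fun t ↦ contMDiffAt_val_apply_along g hn (hTl₁ t) (hTl₁ t)
  have hsm₂ : ContMDiff 𝓘(ℝ, ℝ) 𝓘(ℝ, ℝ) ∞ (fun t ↦ g.val (x₂ t σ) (velocity I (fun t' ↦ x₂ t' σ) t)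
      (velocity I (fun t' ↦ x₂ t' σ) t)) :=
    fun t ↦ contMDiffAt_val_apply_along g hn (hTl₂ t) (hTl₂ t)
  have hf₁c : Continuous fun t ↦ g.val (x₁ t σ) (velocity I (fun t' ↦ x₁ t' σ) t)
      (velocity I (fun t' ↦ x₁ t' σ) t) := hsm₁.continuous
  have hf₂c : Continuous fun t ↦ g.val (x₂ t σ) (velocity I (fun t' ↦ x₂ t' σ) t)
      (velocity I (fun t' ↦ x₂ t' σ) t) := hsm₂.continuous
  -- the curves are `C¹`
  have h1le : (1 : ℕ∞ω) ≤ ∞ := by exact_mod_cast le_top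
  have hc₁ : ContMDiffOn 𝓘(ℝ, ℝ) I 1 (fun t ↦ x₁ t σ) (Icc 0 1) := (hγ₁.of_le h1le).contMDiffOn
  have hc₂ : ContMDiffOn 𝓘(ℝ, ℝ) I 1 (fun t ↦ x₂ t σ) (Icc 1 s₀) := (hγ₂.of_le h1le).contMDiffOn
  -- endpoints
  have hγ0 : expMap g.leviCivita p ((0 : ℝ) • u) = p := by
    rw [zero_smul]
    exact expMap_zero (cov := g.leviCivita) p
  have e0 : x₁ 0 σ = p := by
    show expMap g.leviCivita (expMap g.leviCivita p ((0 : ℝ) • u)) (σ • X₁ 0) = p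
    rw [h0, smul_zero, expMap_zero (cov := g.leviCivita)]
    exact hγ0
  have e1 : x₁ 1 σ = x₂ 1 σ := by
    show expMap g.leviCivita (expMap g.leviCivita p ((1 : ℝ) • u)) (σ • X₁ 1) =
      expMap g.leviCivita (expMap g.leviCivita p ((1 : ℝ) • u)) (σ • X₂ 1)
    rw [h1]
  have es : x₂ s₀ σ = expMap g.leviCivita p (s₀ • u) := by
    show expMap g.leviCivita (expMap g.leviCivita p (s₀ • u)) (σ • X₂ s₀) =
      expMap g.leviCivita p (s₀ • u)
    rw [hs, smul_zero]
    exact expMap_zero (cov := g.leviCivita) _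
  -- the distance from `p` to `γ s₀` is at most the sum of the two lengths
  have hd : g.edist hg p (expMap g.leviCivita p (s₀ • u)) ≤
      g.length hg (fun t ↦ x₁ t σ) 0 1 + g.length hg (fun t ↦ x₂ t σ) 1 s₀ := by
    have h₁ : g.edist hg (x₁ 0 σ) (x₁ 1 σ) ≤ g.length hg (fun t ↦ x₁ t σ) 0 1 :=
      g.edist_le_length hg zero_le_one hc₁
    have h₂ : g.edist hg (x₂ 1 σ) (x₂ s₀ σ) ≤ g.length hg (fun t ↦ x₂ t σ) 1 s₀ :=
      g.edist_le_length hg hs₀.le hc₂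
    rw [e0, e1] at h₁
    rw [es] at h₂
    exact (g.edist_triangle hg p (x₂ 1 σ) _).trans (add_le_add h₁ h₂)
  -- lengths as real integrals
  have hL₁ := length_eq_ofReal_integral g hg zero_le_one hf₁c
  have hL₂ := length_eq_ofReal_integral g hg hs₀.le hf₂c
  -- minimality: `d(p, γ s₀) = s₀ |u|`
  have hd_eq : g.edist hg p (expMap g.leviCivita p (s₀ • u)) =
      ENNReal.ofReal (s₀ * Real.sqrt (g.val p u u)) := by
    rw [expMap_smul hc p u s₀, ← hmin.2, length_maximalGeodesic hg hc p u 0 s₀, sub_zero]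
  have hℓ₁ : 0 ≤ ∫ t in (0 : ℝ)..1, Real.sqrt (g.val (x₁ t σ) (velocity I (fun t' ↦ x₁ t' σ) t)
      (velocity I (fun t' ↦ x₁ t' σ) t)) :=
    intervalIntegral.integral_nonneg zero_le_one fun t _ ↦ Real.sqrt_nonneg _
  have hℓ₂ : 0 ≤ ∫ t in (1 : ℝ)..s₀, Real.sqrt (g.val (x₂ t σ) (velocity I (fun t' ↦ x₂ t' σ) t)
      (velocity I (fun t' ↦ x₂ t' σ) t)) :=
    intervalIntegral.integral_nonneg hs₀.le fun t _ ↦ Real.sqrt_nonneg _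
  have hsum : s₀ * Real.sqrt (g.val p u u) ≤
      (∫ t in (0 : ℝ)..1, Real.sqrt (g.val (x₁ t σ) (velocity I (fun t' ↦ x₁ t' σ) t)
        (velocity I (fun t' ↦ x₁ t' σ) t))) +
      ∫ t in (1 : ℝ)..s₀, Real.sqrt (g.val (x₂ t σ) (velocity I (fun t' ↦ x₂ t' σ) t)
        (velocity I (fun t' ↦ x₂ t' σ) t)) := by
    have h := hd
    rw [hd_eq, hL₁, hL₂, ← ENNReal.ofReal_add hℓ₁ hℓ₂] at h
    exact (ENNReal.ofReal_le_ofReal_iff (add_nonneg hℓ₁ hℓ₂)).1 h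
  -- Cauchy–Schwarz on each piece
  have hsc₁ : Continuous fun t ↦ Real.sqrt (g.val (x₁ t σ) (velocity I (fun t' ↦ x₁ t' σ) t)
      (velocity I (fun t' ↦ x₁ t' σ) t)) := Real.continuous_sqrt.comp hf₁c
  have hsc₂ : Continuous fun t ↦ Real.sqrt (g.val (x₂ t σ) (velocity I (fun t' ↦ x₂ t' σ) t)
      (velocity I (fun t' ↦ x₂ t' σ) t)) := Real.continuous_sqrt.comp hf₂c
  have hCS₁ := sq_intervalIntegral_le_length_mul_of_continuous hsc₁ zero_le_one
  have hCS₂ := sq_intervalIntegral_le_length_mul_of_continuous hsc₂ hs₀.le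
  have hsq₁ : (fun t ↦ Real.sqrt (g.val (x₁ t σ) (velocity I (fun t' ↦ x₁ t' σ) t)
      (velocity I (fun t' ↦ x₁ t' σ) t)) ^ 2) =
      fun t ↦ g.val (x₁ t σ) (velocity I (fun t' ↦ x₁ t' σ) t) (velocity I (fun t' ↦ x₁ t' σ) t) :=
    funext fun t ↦ Real.sq_sqrt (hnn _ _)
  have hsq₂ : (fun t ↦ Real.sqrt (g.val (x₂ t σ) (velocity I (fun t' ↦ x₂ t' σ) t)
      (velocity I (fun t' ↦ x₂ t' σ) t)) ^ 2) =
      fun t ↦ g.val (x₂ t σ) (velocity I (fun t' ↦ x₂ t' σ) t) (velocity I (fun t' ↦ x₂ t' σ) t) :=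
    funext fun t ↦ Real.sq_sqrt (hnn _ _)
  rw [hsq₁, sub_zero, one_mul] at hCS₁
  rw [hsq₂] at hCS₂
  -- algebra
  have hg0 : 0 ≤ g.val p u u := hnn p u
  have hsq : (s₀ * Real.sqrt (g.val p u u)) ^ 2 = s₀ ^ 2 * g.val p u u := by
    rw [mul_pow, Real.sq_sqrt hg0]
  have h4 : s₀ ^ 2 * g.val p u u ≤
      (((∫ t in (0 : ℝ)..1, Real.sqrt (g.val (x₁ t σ) (velocity I (fun t' ↦ x₁ t' σ) t)
        (velocity I (fun t' ↦ x₁ t' σ) t))) +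
      ∫ t in (1 : ℝ)..s₀, Real.sqrt (g.val (x₂ t σ) (velocity I (fun t' ↦ x₂ t' σ) t)
        (velocity I (fun t' ↦ x₂ t' σ) t)))) ^ 2 := by
    rw [← hsq]
    exact pow_le_pow_left₀ (mul_nonneg (by linarith) (Real.sqrt_nonneg _)) hsum 2
  have hs₀pos : 0 < s₀ := by linarith
  show s₀ * g.val p u u ≤
    (∫ t in (0 : ℝ)..1, g.val (x₁ t σ) (velocity I (fun t' ↦ x₁ t' σ) t)
      (velocity I (fun t' ↦ x₁ t' σ) t)) +
    ∫ t in (1 : ℝ)..s₀, g.val (x₂ t σ) (velocity I (fun t' ↦ x₂ t' σ) t)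
      (velocity I (fun t' ↦ x₂ t' σ) t)
  set ℓ₁ : ℝ := ∫ t in (0 : ℝ)..1, Real.sqrt (g.val (x₁ t σ) (velocity I (fun t' ↦ x₁ t' σ) t)
      (velocity I (fun t' ↦ x₁ t' σ) t)) with hℓ₁_def
  set ℓ₂ : ℝ := ∫ t in (1 : ℝ)..s₀, Real.sqrt (g.val (x₂ t σ) (velocity I (fun t' ↦ x₂ t' σ) t)
      (velocity I (fun t' ↦ x₂ t' σ) t)) with hℓ₂_def
  set A₁ : ℝ := ∫ t in (0 : ℝ)..1, g.val (x₁ t σ) (velocity I (fun t' ↦ x₁ t' σ) t)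
      (velocity I (fun t' ↦ x₁ t' σ) t) with hA₁_def
  set A₂ : ℝ := ∫ t in (1 : ℝ)..s₀, g.val (x₂ t σ) (velocity I (fun t' ↦ x₂ t' σ) t)
      (velocity I (fun t' ↦ x₂ t' σ) t) with hA₂_def
  have hid : (s₀ - 1) * (s₀ * (A₁ + A₂)) - (s₀ - 1) * (ℓ₁ + ℓ₂) ^ 2 =
      (s₀ - 1) * s₀ * (A₁ - ℓ₁ ^ 2) + s₀ * ((s₀ - 1) * A₂ - ℓ₂ ^ 2) +
        ((s₀ - 1) * ℓ₁ - ℓ₂) ^ 2 := by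
    ring
  have t1 : 0 ≤ (s₀ - 1) * s₀ * (A₁ - ℓ₁ ^ 2) :=
    mul_nonneg (mul_nonneg (by linarith) hs₀pos.le) (by linarith)
  have t2 : 0 ≤ s₀ * ((s₀ - 1) * A₂ - ℓ₂ ^ 2) := mul_nonneg hs₀pos.le (by linarith)
  have t3 : 0 ≤ ((s₀ - 1) * ℓ₁ - ℓ₂) ^ 2 := sq_nonneg _
  have h5 : (s₀ - 1) * (ℓ₁ + ℓ₂) ^ 2 ≤ (s₀ - 1) * (s₀ * (A₁ + A₂)) := by linarith
  have h6 : (ℓ₁ + ℓ₂) ^ 2 ≤ s₀ * (A₁ + A₂) := le_of_mul_le_mul_left h5 (by linarith)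
  have h7 : s₀ * (s₀ * g.val p u u) ≤ s₀ * (A₁ + A₂) := by
    have : s₀ * (s₀ * g.val p u u) = s₀ ^ 2 * g.val p u u := by ring
    rw [this]
    exact h4.trans h6
  exact le_of_mul_le_mul_left h7 hs₀pos

/-- **Minimizing geodesics have nonnegative index form** (Lee 2018, Cor. 10.23 / proof of
Thm. 10.26: "if `Γ` is a proper variation of a minimizing geodesic segment then
`d²/ds²|_{s=0} L_g(Γ_s) ≥ 0`", in the index-form notation `I(V, V) ≥ 0` for proper piecewise
smooth `V`, p. 304), here for the energy and the broken field (`X₁` on `[0,1]`, `X₂` on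
`[1,s₀]`): if `γ(t) = exp_p(tu)` minimizes on `[0, s₀]`, `s₀ > 1`, and `X₁(0) = 0`,
`X₁(1) = X₂(1)`, `X₂(s₀) = 0` (`C^∞` lifts), then
`0 ≤ ∫_0^1 [g(R(X₁,γ')X₁,γ') + |D_tX₁|²] + ∫_1^{s₀} [g(R(X₂,γ')X₂,γ') + |D_tX₂|²]`. Proof: the
energy `A(σ)` of the broken variation satisfies `A(σ) ≥ s₀ g(u,u) = A(0)`
(`energy_ge_of_isMinimizingUpTo`) and the Taylor bound `integral_energy_le_taylor`; the first-order
terms `∫ 2 g(D_tXᵢ, γ')` are boundary terms (`integral_val_covariantDerivAlong_velocity`, Thm. 6.3)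
which cancel, so `0 ≤ σ²(I + ε s₀)` for small `σ > 0` and every `ε > 0`.
[cite: LeeRiemannianManifolds2018, Cor. 10.23 and Thm. 10.26 (proof)] -/
theorem index_nonneg_of_isMinimizingUpTo (hn : (∞ : ℕ∞ω) ≤ n) (hg : g.IsRiemannian)
    (hc : IsGeodesicallyComplete g.leviCivita) (p : M) (u : TangentSpace I p) {s₀ : ℝ}
    (hs₀ : 1 < s₀) (hmin : IsMinimizingUpTo g hg p u s₀)
    {X₁ X₂ : Π t : ℝ, TangentSpace I (expMap g.leviCivita p (t • u))}
    (hX₁ : ContMDiff 𝓘(ℝ, ℝ) I.tangent ∞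
      (fun t ↦ (TotalSpace.mk' E (expMap g.leviCivita p (t • u)) (X₁ t) : TangentBundle I M)))
    (hX₂ : ContMDiff 𝓘(ℝ, ℝ) I.tangent ∞
      (fun t ↦ (TotalSpace.mk' E (expMap g.leviCivita p (t • u)) (X₂ t) : TangentBundle I M)))
    (h0 : X₁ 0 = 0) (h1 : X₁ 1 = X₂ 1) (hs : X₂ s₀ = 0) :
    0 ≤ (∫ t in (0 : ℝ)..1,
        (g.val (expMap g.leviCivita p (t • u))
          (g.leviCivita.curvature (expMap g.leviCivita p (t • u)) (X₁ t)
            (velocity I (fun t ↦ expMap g.leviCivita p (t • u)) t) (X₁ t))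
          (velocity I (fun t ↦ expMap g.leviCivita p (t • u)) t) +
        g.val (expMap g.leviCivita p (t • u))
          (covariantDerivAlong g.leviCivita (fun t ↦ expMap g.leviCivita p (t • u)) X₁ t)
          (covariantDerivAlong g.leviCivita (fun t ↦ expMap g.leviCivita p (t • u)) X₁ t))) +
      ∫ t in (1 : ℝ)..s₀,
        (g.val (expMap g.leviCivita p (t • u))
          (g.leviCivita.curvature (expMap g.leviCivita p (t • u)) (X₂ t)
            (velocity I (fun t ↦ expMap g.leviCivita p (t • u)) t) (X₂ t))
          (velocity I (fun t ↦ expMap g.leviCivita p (t • u)) t) +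
        g.val (expMap g.leviCivita p (t • u))
          (covariantDerivAlong g.leviCivita (fun t ↦ expMap g.leviCivita p (t • u)) X₂ t)
          (covariantDerivAlong g.leviCivita (fun t ↦ expMap g.leviCivita p (t • u)) X₂ t)) := by
  haveI : Fact (1 ≤ n) := ⟨le_trans (by exact_mod_cast le_top) hn⟩
  -- Taylor bounds on both pieces
  obtain ⟨-, hT₁⟩ := integral_energy_le_taylor g hn hc hX₁ (zero_le_one (α := ℝ))
  obtain ⟨-, hT₂⟩ := integral_energy_le_taylor g hn hc hX₂ hs₀.le
  -- the geodesic `γ_u` and the first-variation terms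
  have hgeo : IsGeodesic g.leviCivita (fun t ↦ expMap g.leviCivita p (t • u)) :=
    isGeodesic_expMap_smul_of_isGeodesicallyComplete hc p u
  have hγ : ContMDiff 𝓘(ℝ, ℝ) I ∞ (fun t ↦ expMap g.leviCivita p (t • u)) :=
    fun t ↦ (contMDiffAt_totalSpace.1 (hX₁ t)).1
  have hF₁ := integral_val_covariantDerivAlong_velocity g hn hgeo hγ hX₁ 0 1
  have hF₂ := integral_val_covariantDerivAlong_velocity g hn hgeo hγ hX₂ 1 s₀
  have hF₁' : ∫ t in (0 : ℝ)..1, 2 * g.val (expMap g.leviCivita p (t • u))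
      (covariantDerivAlong g.leviCivita (fun t ↦ expMap g.leviCivita p (t • u)) X₁ t)
      (velocity I (fun t ↦ expMap g.leviCivita p (t • u)) t) =
      2 * (g.val (expMap g.leviCivita p ((1 : ℝ) • u)) (X₁ 1)
          (velocity I (fun t ↦ expMap g.leviCivita p (t • u)) 1) -
        g.val (expMap g.leviCivita p ((0 : ℝ) • u)) (X₁ 0)
          (velocity I (fun t ↦ expMap g.leviCivita p (t • u)) 0)) := by
    rw [intervalIntegral.integral_const_mul, hF₁]
  have hF₂' : ∫ t in (1 : ℝ)..s₀, 2 * g.val (expMap g.leviCivita p (t • u))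
      (covariantDerivAlong g.leviCivita (fun t ↦ expMap g.leviCivita p (t • u)) X₂ t)
      (velocity I (fun t ↦ expMap g.leviCivita p (t • u)) t) =
      2 * (g.val (expMap g.leviCivita p (s₀ • u)) (X₂ s₀)
          (velocity I (fun t ↦ expMap g.leviCivita p (t • u)) s₀) -
        g.val (expMap g.leviCivita p ((1 : ℝ) • u)) (X₂ 1)
          (velocity I (fun t ↦ expMap g.leviCivita p (t • u)) 1)) := by
    rw [intervalIntegral.integral_const_mul, hF₂]
  -- the boundary terms cancel
  have hbd : 2 * (g.val (expMap g.leviCivita p ((1 : ℝ) • u)) (X₁ 1)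
          (velocity I (fun t ↦ expMap g.leviCivita p (t • u)) 1) -
        g.val (expMap g.leviCivita p ((0 : ℝ) • u)) (X₁ 0)
          (velocity I (fun t ↦ expMap g.leviCivita p (t • u)) 0)) +
      2 * (g.val (expMap g.leviCivita p (s₀ • u)) (X₂ s₀)
          (velocity I (fun t ↦ expMap g.leviCivita p (t • u)) s₀) -
        g.val (expMap g.leviCivita p ((1 : ℝ) • u)) (X₂ 1)
          (velocity I (fun t ↦ expMap g.leviCivita p (t • u)) 1)) = 0 := by
    rw [h0, h1, hs, map_zero, map_zero]
    simp
  -- the energy of `γ_u` on the two pieces (constant speed)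
  have hγ0 : expMap g.leviCivita p ((0 : ℝ) • u) = p := by
    rw [zero_smul]
    exact expMap_zero (cov := g.leviCivita) p
  have hspeed : ∀ t, g.val (expMap g.leviCivita p (t • u))
      (velocity I (fun t ↦ expMap g.leviCivita p (t • u)) t)
      (velocity I (fun t ↦ expMap g.leviCivita p (t • u)) t) = g.val p u u := by
    intro t
    have h := g.val_velocity_eq_of_isGeodesicOn_holds isOpen_univ ordConnected_univ hgeo
      (mem_univ t) (mem_univ 0)
    have hv0 : (velocity I (fun t ↦ expMap g.leviCivita p (t • u)) 0 : E) = (u : E) :=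
      velocity_expMap_smul_zero p u
    have h' : g.val (expMap g.leviCivita p (t • u))
        (velocity I (fun t ↦ expMap g.leviCivita p (t • u)) t)
        (velocity I (fun t ↦ expMap g.leviCivita p (t • u)) t) =
        g.val (expMap g.leviCivita p ((0 : ℝ) • u))
          (velocity I (fun t ↦ expMap g.leviCivita p (t • u)) 0)
          (velocity I (fun t ↦ expMap g.leviCivita p (t • u)) 0) := h
    rw [h', hv0, hγ0]
  have hE₁ : ∫ t in (0 : ℝ)..1, g.val (expMap g.leviCivita p (t • u))
      (velocity I (fun t ↦ expMap g.leviCivita p (t • u)) t)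
      (velocity I (fun t ↦ expMap g.leviCivita p (t • u)) t) = g.val p u u := by
    simp_rw [hspeed]
    rw [intervalIntegral.integral_const, smul_eq_mul]
    ring
  have hE₂ : ∫ t in (1 : ℝ)..s₀, g.val (expMap g.leviCivita p (t • u))
      (velocity I (fun t ↦ expMap g.leviCivita p (t • u)) t)
      (velocity I (fun t ↦ expMap g.leviCivita p (t • u)) t) = (s₀ - 1) * g.val p u u := by
    simp_rw [hspeed]
    rw [intervalIntegral.integral_const, smul_eq_mul]
  -- suppose the index were negative
  by_contra hneg
  push Not at hneg
  have hs₀pos : 0 < s₀ := by linarith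
  set Q₁ : ℝ := ∫ t in (0 : ℝ)..1,
        (g.val (expMap g.leviCivita p (t • u))
          (g.leviCivita.curvature (expMap g.leviCivita p (t • u)) (X₁ t)
            (velocity I (fun t ↦ expMap g.leviCivita p (t • u)) t) (X₁ t))
          (velocity I (fun t ↦ expMap g.leviCivita p (t • u)) t) +
        g.val (expMap g.leviCivita p (t • u))
          (covariantDerivAlong g.leviCivita (fun t ↦ expMap g.leviCivita p (t • u)) X₁ t)
          (covariantDerivAlong g.leviCivita (fun t ↦ expMap g.leviCivita p (t • u)) X₁ t))
    with hQ₁_def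
  set Q₂ : ℝ := ∫ t in (1 : ℝ)..s₀,
        (g.val (expMap g.leviCivita p (t • u))
          (g.leviCivita.curvature (expMap g.leviCivita p (t • u)) (X₂ t)
            (velocity I (fun t ↦ expMap g.leviCivita p (t • u)) t) (X₂ t))
          (velocity I (fun t ↦ expMap g.leviCivita p (t • u)) t) +
        g.val (expMap g.leviCivita p (t • u))
          (covariantDerivAlong g.leviCivita (fun t ↦ expMap g.leviCivita p (t • u)) X₂ t)
          (covariantDerivAlong g.leviCivita (fun t ↦ expMap g.leviCivita p (t • u)) X₂ t))
    with hQ₂_def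
  set ε : ℝ := -(Q₁ + Q₂) / (2 * s₀) with hε_def
  have hε : 0 < ε := div_pos (by linarith) (by linarith)
  obtain ⟨δ₁, hδ₁, hT₁'⟩ := hT₁ ε hε
  obtain ⟨δ₂, hδ₂, hT₂'⟩ := hT₂ ε hε
  obtain ⟨σ, hσ_def⟩ : ∃ σ : ℝ, σ = min δ₁ δ₂ := ⟨_, rfl⟩
  have hσ : 0 < σ := by
    rw [hσ_def]
    exact lt_min hδ₁ hδ₂
  have hσ₁ : σ ∈ Icc (0 : ℝ) δ₁ := ⟨hσ.le, by rw [hσ_def]; exact min_le_left _ _⟩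
  have hσ₂ : σ ∈ Icc (0 : ℝ) δ₂ := ⟨hσ.le, by rw [hσ_def]; exact min_le_right _ _⟩
  have h₁ := hT₁' σ hσ₁
  have h₂ := hT₂' σ hσ₂
  have hA := energy_ge_of_isMinimizingUpTo g hn hg hc p u hs₀ hmin hX₁ hX₂ h0 h1 hs σ
  -- bookkeeping of the first- and second-order terms
  have hσF : σ * (∫ t in (0 : ℝ)..1, 2 * g.val (expMap g.leviCivita p (t • u))
        (covariantDerivAlong g.leviCivita (fun t ↦ expMap g.leviCivita p (t • u)) X₁ t)
        (velocity I (fun t ↦ expMap g.leviCivita p (t • u)) t)) +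
      σ * (∫ t in (1 : ℝ)..s₀, 2 * g.val (expMap g.leviCivita p (t • u))
        (covariantDerivAlong g.leviCivita (fun t ↦ expMap g.leviCivita p (t • u)) X₂ t)
        (velocity I (fun t ↦ expMap g.leviCivita p (t • u)) t)) = 0 := by
    rw [hF₁', hF₂', ← mul_add, hbd, mul_zero]
  have hring : σ * σ * (Q₁ + ε * (1 - 0)) + σ * σ * (Q₂ + ε * (s₀ - 1)) =
      σ * σ * (Q₁ + Q₂ + ε * s₀) := by ring
  have key : 0 ≤ σ * σ * (Q₁ + Q₂ + ε * s₀) := by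
    linarith [h₁, h₂, hA, hE₁, hE₂, hσF, hring]
  have hQε : 0 ≤ Q₁ + Q₂ + ε * s₀ := (mul_nonneg_iff_of_pos_left (mul_pos hσ hσ)).1 key
  have hεs : ε * s₀ = -(Q₁ + Q₂) / 2 := by
    rw [hε_def]
    field_simp
  rw [hεs] at hQε
  linarith

end Literature.Geometry.Riemannian

end
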